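import Summits.BirchSwinnertonDyer.BirchSwinnertonDyer.Theorems.CyclotomicUntwistPSLocalThreeStableLineIIstar
import HarnessLib

/-!
# Valued-field algebra for the DICYCLIC wild rows at `3`, part 1: Tate's `II` shape with `w Δ = e⁻⁵` and the
# `IV` shape with `w Δ = e⁻⁷` (all roots of `Ψ₃` in `3𝒪`, at most one of them)

Cell `pub/bsd-wall` (D-0145 line `route-BirchSwinnertonDyer-CyclotomicUntwist`), seat `bsd-line-cycu-p2`
(prover seat 2/3, gen 3); helper toward K1/K2 (stmt-BirchSwinnertonDyer-21580 / 21581) and the O6 lane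
(`WildThreeTameTorsionCellLaw`, conjecture-tagged: IRR / SPLIT occur only in the cells `(3, II)`, `(3, IV*)` —
its SPLIT half needs "at most one `ℚ₃`-root of `Ψ₃`" on the six other dicyclic cells; the `IV*`/`II*` cells
reduce to the shapes here by the weight rescaling `bᵢ ↦ bᵢ/3^{i/2}`). THEOREMS ONLY over an abstract valued
field `(F, w)` with `w 3 = e⁻¹` (no definition, no named fact, no `sorry`); BSD is not proved by this file and
no crux is.

* `root_eq_root_of_smallCoeffs'`: a monic quartic with `w c₃ ≤ e⁻¹`, `w c₂ ≤ e⁻²`, `e⁻³ < w c₁` has at most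
  one root of valuation `≤ e⁻¹`; `root_unique_of_linear_dominance`: the `Ψ₃`-form corollary.
* `shapeII_five_bounds`: `b₂, b₄, b₆ ∈ 3𝒪`, `w b₆ = e⁻¹`, `w Δ = e⁻⁵` ⟹ `w b₂ ≤ e⁻²`, `w b₄ ≤ e⁻²`, `w b₈ ≤ e⁻³`
  (else `8b₄³` resp. `b₂²b₈` dominates `Δ` strictly at `e⁻³` resp. `e⁻⁴`) — rows `(≥3,4,5)` II and, rescaled,
  `(≥5,7,11)` IV*.
* `shapeIV_seven_bounds`: `b₂ ∈ 3𝒪, b₄ ∈ 9𝒪`, `w b₆ = e⁻²`, `w Δ = e⁻⁷` ⟹ `w b₂ ≤ e⁻²`, `w b₄ ≤ e⁻³`,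
  `w b₈ ≤ e⁻⁴` — rows `(≥4,5,7)` IV and, rescaled, `(≥6,8,13)` II*.
References: J. H. Silverman, *Advanced Topics* (1994), IV.9.4 Steps 3, 5 [SilvermanATAEC1994]; I. Papadopoulos,
J. Number Theory 44 (1993), Table (p = 3) [Papadopoulos1993].
-/

set_option autoImplicit false
-- single-conjunct summit: `Summit.BirchSwinnertonDyer.BirchSwinnertonDyer.…` repeats the name by design
set_option linter.dupNamespace false

noncomputable section

open scoped Classical

open WeierstrassCurve WithZero Summit.BirchSwinnertonDyer.Rank1Residual.O5.NonSplitAtThree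

open Summit.BirchSwinnertonDyer.Rank1Residual.Additive.ThreeAdicLift (le_exp_sub_one_of_lt_exp)

namespace Summit.BirchSwinnertonDyer.BirchSwinnertonDyer.Theorems.PSLocalThreeTorsion

section Valued

variable {F : Type*} [Field F] (w : Valuation F ℤᵐ⁰) {ϖ : F}

/-- **At most one small root, general linear dominance.** For `r⁴ + c₃r³ + c₂r² + c₁r + c₀` with `w c₃ ≤ e⁻¹`,
`w c₂ ≤ e⁻²` and `e⁻³ < w c₁`, two roots `r, s` with `w r, w s ≤ e⁻¹` coincide (the difference quotient is
`c₁ +` terms of valuation `≤ e⁻³`). [folklore] -/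
theorem root_eq_root_of_smallCoeffs' {c₃ c₂ c₁ c₀ r s : F} (h₃ : w c₃ ≤ exp (-1 : ℤ))
    (h₂ : w c₂ ≤ exp (-2 : ℤ)) (h₁ : exp (-3 : ℤ) < w c₁) (hr1 : w r ≤ exp (-1 : ℤ))
    (hs1 : w s ≤ exp (-1 : ℤ)) (hr : r ^ 4 + c₃ * r ^ 3 + c₂ * r ^ 2 + c₁ * r + c₀ = 0)
    (hs : s ^ 4 + c₃ * s ^ 3 + c₂ * s ^ 2 + c₁ * s + c₀ = 0) : r = s := by
  by_contra hne
  have hrs : r - s ≠ 0 := sub_ne_zero.mpr hne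
  have hq : (r ^ 3 + r ^ 2 * s + r * s ^ 2 + s ^ 3) + c₃ * (r ^ 2 + r * s + s ^ 2) + c₂ * (r + s) + c₁ = 0 := by
    have h : (r - s) * ((r ^ 3 + r ^ 2 * s + r * s ^ 2 + s ^ 3) + c₃ * (r ^ 2 + r * s + s ^ 2) +
        c₂ * (r + s) + c₁) = (r ^ 4 + c₃ * r ^ 3 + c₂ * r ^ 2 + c₁ * r + c₀) -
          (s ^ 4 + c₃ * s ^ 3 + c₂ * s ^ 2 + c₁ * s + c₀) := by ring
    rw [hr, hs, sub_zero, mul_eq_zero] at h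
    exact h.resolve_left hrs
  have m2 : ∀ {x y : F}, w x ≤ exp (-1 : ℤ) → w y ≤ exp (-1 : ℤ) → w (x * y) ≤ exp (-2 : ℤ) := by
    intro x y hx hy
    calc w (x * y) ≤ exp (-1 + -1 : ℤ) := map_mul_le_exp_add w hx hy
      _ = exp (-2 : ℤ) := by norm_num
  have m3 : ∀ {x y z : F}, w x ≤ exp (-1 : ℤ) → w y ≤ exp (-1 : ℤ) → w z ≤ exp (-1 : ℤ) →
      w (x * y * z) ≤ exp (-3 : ℤ) := by
    intro x y z hx hy hz
    calc w (x * y * z) ≤ exp (-2 + -1 : ℤ) := map_mul_le_exp_add w (m2 hx hy) hz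
      _ = exp (-3 : ℤ) := by norm_num
  have hA : w (r ^ 3 + r ^ 2 * s + r * s ^ 2 + s ^ 3) ≤ exp (-3 : ℤ) := by
    rw [show r ^ 3 + r ^ 2 * s + r * s ^ 2 + s ^ 3 = r * r * r + r * r * s + r * s * s + s * s * s by ring]
    exact Valuation.map_add_le w (Valuation.map_add_le w (Valuation.map_add_le w (m3 hr1 hr1 hr1)
      (m3 hr1 hr1 hs1)) (m3 hr1 hs1 hs1)) (m3 hs1 hs1 hs1)
  have hB : w (c₃ * (r ^ 2 + r * s + s ^ 2)) ≤ exp (-3 : ℤ) := by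
    have h : w (r ^ 2 + r * s + s ^ 2) ≤ exp (-2 : ℤ) := by
      rw [show r ^ 2 + r * s + s ^ 2 = r * r + r * s + s * s by ring]
      exact Valuation.map_add_le w (Valuation.map_add_le w (m2 hr1 hr1) (m2 hr1 hs1)) (m2 hs1 hs1)
    calc w (c₃ * (r ^ 2 + r * s + s ^ 2)) ≤ exp (-1 + -2 : ℤ) := map_mul_le_exp_add w h₃ h
      _ = exp (-3 : ℤ) := by norm_num
  have hC : w (c₂ * (r + s)) ≤ exp (-3 : ℤ) := by
    calc w (c₂ * (r + s)) ≤ exp (-2 + -1 : ℤ) := map_mul_le_exp_add w h₂ (Valuation.map_add_le w hr1 hs1)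
      _ = exp (-3 : ℤ) := by norm_num
  have hlt : w ((r ^ 3 + r ^ 2 * s + r * s ^ 2 + s ^ 3) + c₃ * (r ^ 2 + r * s + s ^ 2) + c₂ * (r + s)) <
      w c₁ :=
    lt_of_le_of_lt (Valuation.map_add_le w (Valuation.map_add_le w hA hB) hC) h₁
  have hval := Valuation.map_add_eq_of_lt_right w hlt
  rw [hq, map_zero] at hval
  rw [← hval] at h₁
  exact not_lt_of_ge zero_le h₁

/-- **Type-`II` shape with `w Δ = exp (−5)`: `w b₂ ≤ e⁻²`, `w b₄ ≤ e⁻²`, `w b₈ ≤ e⁻³`.** On `b₂, b₄ ∈ 3𝒪`,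
`w b₆ = e⁻¹`, `4b₈ = b₂b₆ − b₄²`: `w b₄ = e⁻¹` would make `8b₄³` dominate `Δ` at `e⁻³`; `w b₂ = e⁻¹` would
give `w b₈ = e⁻²` and make `b₂²b₈` dominate at `e⁻⁴`. [cite: SilvermanATAEC1994, IV.9.4 Step 3] -/
theorem shapeII_five_bounds (h3 : (3 : F) = ϖ) (hϖ : w ϖ = exp (-1 : ℤ)) {b₂ b₄ b₆ b₈ : F}
    (hb₂ : w b₂ ≤ exp (-1 : ℤ)) (hb₄ : w b₄ ≤ exp (-1 : ℤ)) (hb₆ : w b₆ = exp (-1 : ℤ))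
    (hrel : 4 * b₈ = b₂ * b₆ - b₄ ^ 2)
    (hΔ : w (-b₂ ^ 2 * b₈ - 8 * b₄ ^ 3 - 27 * b₆ ^ 2 + 9 * b₂ * b₄ * b₆) = exp (-5 : ℤ)) :
    w b₂ ≤ exp (-2 : ℤ) ∧ w b₄ ≤ exp (-2 : ℤ) ∧ w b₈ ≤ exp (-3 : ℤ) := by
  obtain ⟨w4, w8, -, w27, w9⟩ := map_consts w h3 hϖ
  have hT3 : w (27 * b₆ ^ 2) ≤ exp (-5 : ℤ) := by
    rw [map_mul, map_pow, hb₆]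
    calc w 27 * exp (-1 : ℤ) ^ 2 ≤ exp (-3 : ℤ) * exp (-1 : ℤ) ^ 2 := mul_le_mul' w27 le_rfl
      _ = exp (-5 : ℤ) := by rw [← exp_nsmul, ← exp_add]; norm_num
  have hb₈le : w b₈ ≤ exp (-2 : ℤ) := by
    have h : w (4 * b₈) ≤ exp (-2 : ℤ) := by
      rw [hrel]
      refine Valuation.map_sub_le w ?_ ?_
      · calc w (b₂ * b₆) ≤ exp (-1 + -1 : ℤ) := map_mul_le_exp_add w hb₂ hb₆.le
          _ = exp (-2 : ℤ) := by norm_num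
      · rw [map_pow]
        calc w b₄ ^ 2 ≤ exp (-1 : ℤ) ^ 2 := pow_le_pow_left' hb₄ 2
          _ = exp (-2 : ℤ) := by rw [← exp_nsmul]; norm_num
    rwa [map_mul, w4, one_mul] at h
  -- Step 1: `w b₄ ≤ e⁻²`
  have hb₄' : w b₄ ≤ exp (-2 : ℤ) := by
    rcases hb₄.eq_or_lt with h4eq | h4lt
    · exfalso
      have hT1 : w (-b₂ ^ 2 * b₈) ≤ exp (-4 : ℤ) := by
        rw [Valuation.map_mul, Valuation.map_neg, map_pow]
        calc w b₂ ^ 2 * w b₈ ≤ exp (-1 : ℤ) ^ 2 * exp (-2 : ℤ) :=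
              mul_le_mul' (pow_le_pow_left' hb₂ 2) hb₈le
          _ = exp (-4 : ℤ) := by rw [← exp_nsmul, ← exp_add]; norm_num
      have hT2 : w (8 * b₄ ^ 3) = exp (-3 : ℤ) := by
        rw [map_mul, map_pow, w8, one_mul, h4eq, ← exp_nsmul]; norm_num
      have hT4 : w (9 * b₂ * b₄ * b₆) ≤ exp (-5 : ℤ) := by
        rw [map_mul, map_mul, map_mul, h4eq, hb₆]
        calc w 9 * w b₂ * exp (-1 : ℤ) * exp (-1 : ℤ) ≤ exp (-2 : ℤ) * exp (-1 : ℤ) * exp (-1 : ℤ) * exp (-1 : ℤ) :=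
              mul_le_mul' (mul_le_mul' (mul_le_mul' w9 hb₂) le_rfl) le_rfl
          _ = exp (-5 : ℤ) := by rw [← exp_add, ← exp_add, ← exp_add]; norm_num
      have l1 : w (-b₂ ^ 2 * b₈) < w (8 * b₄ ^ 3) := by
        rw [hT2]; exact lt_of_le_of_lt hT1 (by rw [exp_lt_exp]; norm_num)
      have e1 : w (-b₂ ^ 2 * b₈ - 8 * b₄ ^ 3) = exp (-3 : ℤ) := by
        rw [Valuation.map_sub_eq_of_lt_right w l1, hT2]
      have l2 : w (27 * b₆ ^ 2) < w (-b₂ ^ 2 * b₈ - 8 * b₄ ^ 3) := by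
        rw [e1]; exact lt_of_le_of_lt hT3 (by rw [exp_lt_exp]; norm_num)
      have e2 : w (-b₂ ^ 2 * b₈ - 8 * b₄ ^ 3 - 27 * b₆ ^ 2) = exp (-3 : ℤ) := by
        rw [Valuation.map_sub_eq_of_lt_left w l2, e1]
      have l3 : w (9 * b₂ * b₄ * b₆) < w (-b₂ ^ 2 * b₈ - 8 * b₄ ^ 3 - 27 * b₆ ^ 2) := by
        rw [e2]; exact lt_of_le_of_lt hT4 (by rw [exp_lt_exp]; norm_num)
      have e3 : w (-b₂ ^ 2 * b₈ - 8 * b₄ ^ 3 - 27 * b₆ ^ 2 + 9 * b₂ * b₄ * b₆) = exp (-3 : ℤ) := by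
        rw [Valuation.map_add_eq_of_lt_left w l3, e2]
      rw [hΔ, exp_inj] at e3
      norm_num at e3
    · have := le_exp_sub_one_of_lt_exp h4lt
      rwa [show (-1 : ℤ) - 1 = -2 by norm_num] at this
  have hT2 : w (8 * b₄ ^ 3) ≤ exp (-6 : ℤ) := by
    rw [map_mul, map_pow, w8, one_mul]
    calc w b₄ ^ 3 ≤ exp (-2 : ℤ) ^ 3 := pow_le_pow_left' hb₄' 3
      _ = exp (-6 : ℤ) := by rw [← exp_nsmul]; norm_num
  -- Step 2: `w b₂ ≤ e⁻²`
  have hb₂' : w b₂ ≤ exp (-2 : ℤ) := by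
    rcases hb₂.eq_or_lt with h2eq | h2lt
    · exfalso
      have hprod : w (b₂ * b₆) = exp (-2 : ℤ) := by
        rw [map_mul, h2eq, hb₆, ← exp_add]; norm_num
      have hsq : w (b₄ ^ 2) < w (b₂ * b₆) := by
        rw [hprod, map_pow]
        calc w b₄ ^ 2 ≤ exp (-2 : ℤ) ^ 2 := pow_le_pow_left' hb₄' 2
          _ < exp (-2 : ℤ) := by rw [← exp_nsmul, exp_lt_exp]; norm_num
      have hb₈eq : w b₈ = exp (-2 : ℤ) := by
        have h : w (4 * b₈) = exp (-2 : ℤ) := by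
          rw [hrel, Valuation.map_sub_eq_of_lt_left w hsq, hprod]
        rwa [map_mul, w4, one_mul] at h
      have hT1 : w (-b₂ ^ 2 * b₈) = exp (-4 : ℤ) := by
        rw [Valuation.map_mul, Valuation.map_neg, map_pow, h2eq, hb₈eq, ← exp_nsmul, ← exp_add]; norm_num
      have hT4 : w (9 * b₂ * b₄ * b₆) ≤ exp (-6 : ℤ) := by
        rw [map_mul, map_mul, map_mul, h2eq, hb₆]
        calc w 9 * exp (-1 : ℤ) * w b₄ * exp (-1 : ℤ) ≤ exp (-2 : ℤ) * exp (-1 : ℤ) * exp (-2 : ℤ) * exp (-1 : ℤ) :=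
              mul_le_mul' (mul_le_mul' (mul_le_mul' w9 le_rfl) hb₄') le_rfl
          _ = exp (-6 : ℤ) := by rw [← exp_add, ← exp_add, ← exp_add]; norm_num
      have l1 : w (8 * b₄ ^ 3) < w (-b₂ ^ 2 * b₈) := by
        rw [hT1]; exact lt_of_le_of_lt hT2 (by rw [exp_lt_exp]; norm_num)
      have e1 : w (-b₂ ^ 2 * b₈ - 8 * b₄ ^ 3) = exp (-4 : ℤ) := by
        rw [Valuation.map_sub_eq_of_lt_left w l1, hT1]
      have l2 : w (27 * b₆ ^ 2) < w (-b₂ ^ 2 * b₈ - 8 * b₄ ^ 3) := by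
        rw [e1]; exact lt_of_le_of_lt hT3 (by rw [exp_lt_exp]; norm_num)
      have e2 : w (-b₂ ^ 2 * b₈ - 8 * b₄ ^ 3 - 27 * b₆ ^ 2) = exp (-4 : ℤ) := by
        rw [Valuation.map_sub_eq_of_lt_left w l2, e1]
      have l3 : w (9 * b₂ * b₄ * b₆) < w (-b₂ ^ 2 * b₈ - 8 * b₄ ^ 3 - 27 * b₆ ^ 2) := by
        rw [e2]; exact lt_of_le_of_lt hT4 (by rw [exp_lt_exp]; norm_num)
      have e3 : w (-b₂ ^ 2 * b₈ - 8 * b₄ ^ 3 - 27 * b₆ ^ 2 + 9 * b₂ * b₄ * b₆) = exp (-4 : ℤ) := by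
        rw [Valuation.map_add_eq_of_lt_left w l3, e2]
      rw [hΔ, exp_inj] at e3
      norm_num at e3
    · have := le_exp_sub_one_of_lt_exp h2lt
      rwa [show (-1 : ℤ) - 1 = -2 by norm_num] at this
  -- Step 3: `w b₈ ≤ e⁻³`
  refine ⟨hb₂', hb₄', ?_⟩
  have h : w (4 * b₈) ≤ exp (-3 : ℤ) := by
    rw [hrel]
    refine Valuation.map_sub_le w ?_ ?_
    · calc w (b₂ * b₆) ≤ exp (-2 + -1 : ℤ) := map_mul_le_exp_add w hb₂' hb₆.le
        _ = exp (-3 : ℤ) := by norm_num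
    · rw [map_pow]
      calc w b₄ ^ 2 ≤ exp (-2 : ℤ) ^ 2 := pow_le_pow_left' hb₄' 2
        _ ≤ exp (-3 : ℤ) := by rw [← exp_nsmul, exp_le_exp]; norm_num
  rwa [map_mul, w4, one_mul] at h

/-- **Type-`IV` shape with `w Δ = exp (−7)`: `w b₂ ≤ e⁻²`, `w b₄ ≤ e⁻³`, `w b₈ ≤ e⁻⁴`.** On `b₂ ∈ 3𝒪`,
`b₄ ∈ 9𝒪`, `w b₆ = e⁻²`: `w b₂ = e⁻¹` would give `w b₈ = e⁻³` and make `b₂²b₈` dominate `Δ` at `e⁻⁵`;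
then `w b₄ = e⁻²` would make `8b₄³` dominate at `e⁻⁶`. [cite: SilvermanATAEC1994, IV.9.4 Step 5] -/
theorem shapeIV_seven_bounds (h3 : (3 : F) = ϖ) (hϖ : w ϖ = exp (-1 : ℤ)) {b₂ b₄ b₆ b₈ : F}
    (hb₂ : w b₂ ≤ exp (-1 : ℤ)) (hb₄ : w b₄ ≤ exp (-2 : ℤ)) (hb₆ : w b₆ = exp (-2 : ℤ))
    (hrel : 4 * b₈ = b₂ * b₆ - b₄ ^ 2)
    (hΔ : w (-b₂ ^ 2 * b₈ - 8 * b₄ ^ 3 - 27 * b₆ ^ 2 + 9 * b₂ * b₄ * b₆) = exp (-7 : ℤ)) :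
    w b₂ ≤ exp (-2 : ℤ) ∧ w b₄ ≤ exp (-3 : ℤ) ∧ w b₈ ≤ exp (-4 : ℤ) := by
  obtain ⟨w4, w8, -, w27, w9⟩ := map_consts w h3 hϖ
  have hT3 : w (27 * b₆ ^ 2) ≤ exp (-7 : ℤ) := by
    rw [map_mul, map_pow, hb₆]
    calc w 27 * exp (-2 : ℤ) ^ 2 ≤ exp (-3 : ℤ) * exp (-2 : ℤ) ^ 2 := mul_le_mul' w27 le_rfl
      _ = exp (-7 : ℤ) := by rw [← exp_nsmul, ← exp_add]; norm_num
  -- Step 1: `w b₂ ≤ e⁻²`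
  have hb₂' : w b₂ ≤ exp (-2 : ℤ) := by
    rcases hb₂.eq_or_lt with h2eq | h2lt
    · exfalso
      have hprod : w (b₂ * b₆) = exp (-3 : ℤ) := by
        rw [map_mul, h2eq, hb₆, ← exp_add]; norm_num
      have hsq : w (b₄ ^ 2) < w (b₂ * b₆) := by
        rw [hprod, map_pow]
        calc w b₄ ^ 2 ≤ exp (-2 : ℤ) ^ 2 := pow_le_pow_left' hb₄ 2
          _ < exp (-3 : ℤ) := by rw [← exp_nsmul, exp_lt_exp]; norm_num
      have hb₈eq : w b₈ = exp (-3 : ℤ) := by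
        have h : w (4 * b₈) = exp (-3 : ℤ) := by
          rw [hrel, Valuation.map_sub_eq_of_lt_left w hsq, hprod]
        rwa [map_mul, w4, one_mul] at h
      have hT1 : w (-b₂ ^ 2 * b₈) = exp (-5 : ℤ) := by
        rw [Valuation.map_mul, Valuation.map_neg, map_pow, h2eq, hb₈eq, ← exp_nsmul, ← exp_add]; norm_num
      have hT2 : w (8 * b₄ ^ 3) ≤ exp (-6 : ℤ) := by
        rw [map_mul, map_pow, w8, one_mul]
        calc w b₄ ^ 3 ≤ exp (-2 : ℤ) ^ 3 := pow_le_pow_left' hb₄ 3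
          _ = exp (-6 : ℤ) := by rw [← exp_nsmul]; norm_num
      have hT4 : w (9 * b₂ * b₄ * b₆) ≤ exp (-7 : ℤ) := by
        rw [map_mul, map_mul, map_mul, h2eq, hb₆]
        calc w 9 * exp (-1 : ℤ) * w b₄ * exp (-2 : ℤ) ≤ exp (-2 : ℤ) * exp (-1 : ℤ) * exp (-2 : ℤ) * exp (-2 : ℤ) :=
              mul_le_mul' (mul_le_mul' (mul_le_mul' w9 le_rfl) hb₄) le_rfl
          _ = exp (-7 : ℤ) := by rw [← exp_add, ← exp_add, ← exp_add]; norm_num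
      have l1 : w (8 * b₄ ^ 3) < w (-b₂ ^ 2 * b₈) := by
        rw [hT1]; exact lt_of_le_of_lt hT2 (by rw [exp_lt_exp]; norm_num)
      have e1 : w (-b₂ ^ 2 * b₈ - 8 * b₄ ^ 3) = exp (-5 : ℤ) := by
        rw [Valuation.map_sub_eq_of_lt_left w l1, hT1]
      have l2 : w (27 * b₆ ^ 2) < w (-b₂ ^ 2 * b₈ - 8 * b₄ ^ 3) := by
        rw [e1]; exact lt_of_le_of_lt hT3 (by rw [exp_lt_exp]; norm_num)
      have e2 : w (-b₂ ^ 2 * b₈ - 8 * b₄ ^ 3 - 27 * b₆ ^ 2) = exp (-5 : ℤ) := by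
        rw [Valuation.map_sub_eq_of_lt_left w l2, e1]
      have l3 : w (9 * b₂ * b₄ * b₆) < w (-b₂ ^ 2 * b₈ - 8 * b₄ ^ 3 - 27 * b₆ ^ 2) := by
        rw [e2]; exact lt_of_le_of_lt hT4 (by rw [exp_lt_exp]; norm_num)
      have e3 : w (-b₂ ^ 2 * b₈ - 8 * b₄ ^ 3 - 27 * b₆ ^ 2 + 9 * b₂ * b₄ * b₆) = exp (-5 : ℤ) := by
        rw [Valuation.map_add_eq_of_lt_left w l3, e2]
      rw [hΔ, exp_inj] at e3
      norm_num at e3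
    · have := le_exp_sub_one_of_lt_exp h2lt
      rwa [show (-1 : ℤ) - 1 = -2 by norm_num] at this
  have hb₈le : w b₈ ≤ exp (-4 : ℤ) := by
    have h : w (4 * b₈) ≤ exp (-4 : ℤ) := by
      rw [hrel]
      refine Valuation.map_sub_le w ?_ ?_
      · calc w (b₂ * b₆) ≤ exp (-2 + -2 : ℤ) := map_mul_le_exp_add w hb₂' hb₆.le
          _ = exp (-4 : ℤ) := by norm_num
      · rw [map_pow]
        calc w b₄ ^ 2 ≤ exp (-2 : ℤ) ^ 2 := pow_le_pow_left' hb₄ 2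
          _ = exp (-4 : ℤ) := by rw [← exp_nsmul]; norm_num
    rwa [map_mul, w4, one_mul] at h
  -- Step 2: `w b₄ ≤ e⁻³`
  have hb₄' : w b₄ ≤ exp (-3 : ℤ) := by
    rcases hb₄.eq_or_lt with h4eq | h4lt
    · exfalso
      have hT2 : w (8 * b₄ ^ 3) = exp (-6 : ℤ) := by
        rw [map_mul, map_pow, w8, one_mul, h4eq, ← exp_nsmul]; norm_num
      have hT1 : w (-b₂ ^ 2 * b₈) ≤ exp (-8 : ℤ) := by
        rw [Valuation.map_mul, Valuation.map_neg, map_pow]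
        calc w b₂ ^ 2 * w b₈ ≤ exp (-2 : ℤ) ^ 2 * exp (-4 : ℤ) :=
              mul_le_mul' (pow_le_pow_left' hb₂' 2) hb₈le
          _ = exp (-8 : ℤ) := by rw [← exp_nsmul, ← exp_add]; norm_num
      have hT4 : w (9 * b₂ * b₄ * b₆) ≤ exp (-8 : ℤ) := by
        rw [map_mul, map_mul, map_mul, h4eq, hb₆]
        calc w 9 * w b₂ * exp (-2 : ℤ) * exp (-2 : ℤ) ≤ exp (-2 : ℤ) * exp (-2 : ℤ) * exp (-2 : ℤ) * exp (-2 : ℤ) :=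
              mul_le_mul' (mul_le_mul' (mul_le_mul' w9 hb₂') le_rfl) le_rfl
          _ = exp (-8 : ℤ) := by rw [← exp_add, ← exp_add, ← exp_add]; norm_num
      have l1 : w (-b₂ ^ 2 * b₈) < w (8 * b₄ ^ 3) := by
        rw [hT2]; exact lt_of_le_of_lt hT1 (by rw [exp_lt_exp]; norm_num)
      have e1 : w (-b₂ ^ 2 * b₈ - 8 * b₄ ^ 3) = exp (-6 : ℤ) := by
        rw [Valuation.map_sub_eq_of_lt_right w l1, hT2]
      have l2 : w (27 * b₆ ^ 2) < w (-b₂ ^ 2 * b₈ - 8 * b₄ ^ 3) := by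
        rw [e1]; exact lt_of_le_of_lt hT3 (by rw [exp_lt_exp]; norm_num)
      have e2 : w (-b₂ ^ 2 * b₈ - 8 * b₄ ^ 3 - 27 * b₆ ^ 2) = exp (-6 : ℤ) := by
        rw [Valuation.map_sub_eq_of_lt_left w l2, e1]
      have l3 : w (9 * b₂ * b₄ * b₆) < w (-b₂ ^ 2 * b₈ - 8 * b₄ ^ 3 - 27 * b₆ ^ 2) := by
        rw [e2]; exact lt_of_le_of_lt hT4 (by rw [exp_lt_exp]; norm_num)
      have e3 : w (-b₂ ^ 2 * b₈ - 8 * b₄ ^ 3 - 27 * b₆ ^ 2 + 9 * b₂ * b₄ * b₆) = exp (-6 : ℤ) := by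
        rw [Valuation.map_add_eq_of_lt_left w l3, e2]
      rw [hΔ, exp_inj] at e3
      norm_num at e3
    · have := le_exp_sub_one_of_lt_exp h4lt
      rwa [show (-2 : ℤ) - 1 = -3 by norm_num] at this
  exact ⟨hb₂', hb₄', hb₈le⟩

/-- **At most one root on the "linear dominance" shapes** (`w b₂, w b₄ ≤ e⁻²`, `e⁻³ < w b₆ < 1`, `w b₈ ≤ e⁻³`;
both the `II` shape with `w Δ = e⁻⁵` and the `IV` shape with `w Δ = e⁻⁷` after `…_bounds`): every root of
`Ψ₃ = 3x⁴ + b₂x³ + 3b₄x² + 3b₆x + b₈` has valuation `≤ e⁻¹` (monic form `x⁴ + (b₂/3)x³ + b₄x² + b₆x + b₈/3`,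
`map_lt_one_of_root_of_lt_one`) and two roots coincide (`root_eq_root_of_smallCoeffs'`). [folklore] -/
theorem root_unique_of_linear_dominance (h3 : (3 : F) = ϖ) (hϖ : w ϖ = exp (-1 : ℤ)) {b₂ b₄ b₆ b₈ : F}
    (hb₂ : w b₂ ≤ exp (-2 : ℤ)) (hb₄ : w b₄ ≤ exp (-2 : ℤ)) (hb₆ : exp (-3 : ℤ) < w b₆) (hb₆' : w b₆ < 1)
    (hb₈ : w b₈ ≤ exp (-3 : ℤ)) {r s : F}
    (hr : 3 * r ^ 4 + b₂ * r ^ 3 + 3 * b₄ * r ^ 2 + 3 * b₆ * r + b₈ = 0)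
    (hs : 3 * s ^ 4 + b₂ * s ^ 3 + 3 * b₄ * s ^ 2 + 3 * b₆ * s + b₈ = 0) : r = s := by
  have w3 := map_three w h3 hϖ
  have h30 : (3 : F) ≠ 0 := fun h ↦ by rw [h, map_zero] at w3; exact exp_ne_zero w3.symm
  have hmonic : ∀ t : F, 3 * t ^ 4 + b₂ * t ^ 3 + 3 * b₄ * t ^ 2 + 3 * b₆ * t + b₈ = 0 →
      t ^ 4 + b₂ / 3 * t ^ 3 + b₄ * t ^ 2 + b₆ * t + b₈ / 3 = 0 := by
    intro t ht
    field_simp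
    linear_combination ht
  have hc₃ : w (b₂ / 3) ≤ exp (-1 : ℤ) := by
    rw [map_div₀, w3, div_eq_mul_inv, ← exp_neg]
    calc w b₂ * exp (-(-1 : ℤ)) ≤ exp (-2 : ℤ) * exp (-(-1 : ℤ)) := mul_le_mul' hb₂ le_rfl
      _ = exp (-1 : ℤ) := by rw [← exp_add]; norm_num
  have hc₀ : w (b₈ / 3) ≤ exp (-2 : ℤ) := by
    rw [map_div₀, w3, div_eq_mul_inv, ← exp_neg]
    calc w b₈ * exp (-(-1 : ℤ)) ≤ exp (-3 : ℤ) * exp (-(-1 : ℤ)) := mul_le_mul' hb₈ le_rfl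
      _ = exp (-2 : ℤ) := by rw [← exp_add]; norm_num
  have hlt1 : ∀ (a : ℤ), a < 0 → exp a < (1 : ℤᵐ⁰) := fun a ha ↦ by
    rw [← exp_zero, exp_lt_exp]; exact ha
  have hsmall : ∀ t : F, 3 * t ^ 4 + b₂ * t ^ 3 + 3 * b₄ * t ^ 2 + 3 * b₆ * t + b₈ = 0 →
      w t ≤ exp (-1 : ℤ) := by
    intro t ht
    have hlt : w t < 1 :=
      map_lt_one_of_root_of_lt_one w (lt_of_le_of_lt hc₃ (hlt1 (-1) (by norm_num)))
        (lt_of_le_of_lt hb₄ (hlt1 (-2) (by norm_num))) hb₆'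
        (lt_of_le_of_lt hc₀ (hlt1 (-2) (by norm_num))) (hmonic t ht)
    have := le_exp_sub_one_of_lt_exp (n := 0) (by rwa [exp_zero])
    rwa [show (0 : ℤ) - 1 = -1 by norm_num] at this
  exact root_eq_root_of_smallCoeffs' w hc₃ hb₄ hb₆ (hsmall r hr) (hsmall s hs) (hmonic r hr) (hmonic s hs)

end Valued

end Summit.BirchSwinnertonDyer.BirchSwinnertonDyer.Theorems.PSLocalThreeTorsion

end
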